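import Literature.NumberTheory.Automorphic.CompletedCohomologyActionGL
import HarnessLib

/-!
# The `p`-power tower of a tame level: `U_r ◁ U`, and the change-of-level data for the
# spherical Hecke elements

Topic `NumberTheory/Automorphic`; namespace `Literature.NumberTheory.Automorphic`, grouping
sub-namespace `BigHeckeGLn.TameLevel`.  Theorems (and one instance); no named fact.

For an `S`-good tame level datum `𝒰 : TameLevel n K p` (`U = 𝒰.subgroup`, tower
`U_r = 𝒰.tower r`) and a good place `w ∉ S` with spherical Hecke element `t = t_{w,i}` we record
the hypotheses of the change-of-level package `TwistedQuotientLevelChange` /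
`TwistedQuotientLevelChangeNilpotent` for the pair `U_r ≤ U`:

* `tower_zero`: `U_0 = U`;
* `inv_mul_mul_mem_tower`, `mul_mul_inv_mem_tower`: `U` normalises every `U_r`
  (`GL_n(𝒪_v)` normalises the principal congruence subgroups `K_v(ϖ_v^r)`), whence the instance
  `normal_tower_subgroupOf : (U_r ⊓ U ◁ U)`;
* `exists_conj_heckeElement_eq`: for `u ∈ U`, `u t u⁻¹ = a t a⁻¹` with `a = ι_w(u_w) ∈ U_r`, in
  particular `u t u⁻¹ ∈ U_r t U_r` (the hypothesis `hconj` of `TwistedQuotient.heckeProdHom`);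
* `bijOn_subgroup_heckeElement`: the projection `G/U_r → G/U` maps `U_r t U_r / U_r` bijectively
  onto `U t U / U` (the hypothesis of `TwistedQuotient.heckeFun_levelPullback`; same proof as the
  tree's `bijOn_tower_heckeElement` for two tower levels), also in the `translateQuot 1` form
  (`bijOn_subgroup_heckeElement_translateQuot`);
* finiteness of these double cosets (`finite_doubleCosetQuot_tower`,
  `finite_doubleCosetQuot_subgroup`).

## References

* P. Scholze, *On torsion in the cohomology of locally symmetric varieties*, Ann. of Math. 182
  (2015), §V.4 [Scholze2015].
* C. J. Bushnell, G. Henniart, *The local Langlands conjecture for GL(2)* (2006), §1.1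
  [BushnellHenniart2006].
-/

noncomputable section

open scoped NumberField
open IsDedekindDomain

namespace Literature.NumberTheory.Automorphic

/-! ### Conjugation by integral matrices preserves the congruence subgroups -/

section Valued

variable {F Γ₀ : Type*} [Field F] [LinearOrderedCommGroupWithZero Γ₀] [Valued F Γ₀]
  {m : Type*} [Fintype m] [DecidableEq m]

/-- `GL_m(𝒪)` normalises the congruence subgroups: for `u` integral with integral inverse and
`x ≡ 1 (mod {v ≤ c})`, also `u⁻¹ x u ≡ 1 (mod {v ≤ c})` (`u⁻¹ x u - 1 = u⁻¹ (x - 1) u` and the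
ultrametric bound `valued_mul_apply_le`).  A `private` copy of the tree's
`inv_mul_mul_mem_valuedCongruenceSubgroup` (`WhittakerSupportFinite`) /
`conj_mem_valuedCongruenceSubgroup_aux` (`CompletedCohomologyActionGL`, private there), kept private
for the same import-closure reason. [folklore] -/
private theorem conj_mem_valuedCongruenceSubgroup_aux' {c : Γ₀} {u x : GL m F}
    (hu : u ∈ valuedCongruenceSubgroup m (1 : Γ₀)) (hx : x ∈ valuedCongruenceSubgroup m c) :
    u⁻¹ * x * u ∈ valuedCongruenceSubgroup m c := by
  obtain ⟨hu₁, hu₂, -⟩ := hu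
  obtain ⟨hx₁, hx₂, hx₃⟩ := hx
  refine ⟨fun i j => ?_, fun i j => ?_, fun i j => ?_⟩
  · have := valued_mul_apply_le m (valued_mul_apply_le m hu₂ hx₁) hu₁ i j
    simpa only [Units.val_mul, one_mul] using this
  · have := valued_mul_apply_le m (valued_mul_apply_le m hu₂ hx₂) hu₁ i j
    simpa only [mul_inv_rev, inv_inv, Units.val_mul, one_mul, Matrix.mul_assoc] using this
  · have hmat : ((u⁻¹ * x * u : GL m F) : Matrix m m F) - 1 =
        ((u⁻¹ : GL m F) : Matrix m m F) * ((x : Matrix m m F) - 1) * (u : Matrix m m F) := by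
      rw [Matrix.mul_sub, Matrix.sub_mul, Matrix.mul_one, Units.inv_mul, Units.val_mul,
        Units.val_mul]
    rw [hmat]
    have := valued_mul_apply_le m (valued_mul_apply_le m hu₂ hx₃) hu₁ i j
    simpa only [one_mul, mul_one] using this

end Valued

namespace BigHeckeGLn

namespace TameLevel

variable {n : ℕ} {K : Type} [Field K] [NumberField K] {p : ℕ} [Fact p.Prime]
  (𝒰 : TameLevel n K p)

/-! ### `U_0 = U` and `U` normalises the tower -/

/-- **`U_0 = U`**: at radius `0` the congruence condition above `p` is integrality, automatic for
`U ≤ GL_n(𝒪̂_K)`. [folklore] -/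
theorem tower_zero : 𝒰.tower 0 = 𝒰.subgroup := by
  refine le_antisymm (𝒰.tower_le 0) fun u hu => ?_
  rw [mem_tower_iff]
  refine ⟨hu, fun w _ => ?_⟩
  change localComponent n K w u ∈ valuedCongruenceSubgroup (Fin n)
    (WithZero.exp (-((0 : ℕ) : ℤ)) : WithZero (Multiplicative ℤ))
  rw [Nat.cast_zero, neg_zero, WithZero.exp_zero]
  exact localComponent_mem_valuedCongruenceSubgroup_one (𝒰.le_glFiniteIntegralLevel hu) w

/-- **`U` normalises `U_r`**: `u⁻¹ x u ∈ U_r` for `u ∈ U`, `x ∈ U_r`. [folklore] -/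
theorem inv_mul_mul_mem_tower {u x : FiniteAdelicGL n K} (hu : u ∈ 𝒰.subgroup) {r : ℕ}
    (hx : x ∈ 𝒰.tower r) : u⁻¹ * x * u ∈ 𝒰.tower r := by
  rw [mem_tower_iff] at hx ⊢
  refine ⟨𝒰.subgroup.mul_mem (𝒰.subgroup.mul_mem (𝒰.subgroup.inv_mem hu) hx.1) hu,
    fun w hw => ?_⟩
  rw [map_mul, map_mul, map_inv]
  exact conj_mem_valuedCongruenceSubgroup_aux'
    (localComponent_mem_valuedCongruenceSubgroup_one (𝒰.le_glFiniteIntegralLevel hu) w) (hx.2 w hw)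

/-- `u x u⁻¹ ∈ U_r` for `u ∈ U`, `x ∈ U_r`. [folklore] -/
theorem mul_mul_inv_mem_tower {u x : FiniteAdelicGL n K} (hu : u ∈ 𝒰.subgroup) {r : ℕ}
    (hx : x ∈ 𝒰.tower r) : u * x * u⁻¹ ∈ 𝒰.tower r := by
  simpa only [inv_inv] using 𝒰.inv_mul_mul_mem_tower (𝒰.subgroup.inv_mem hu) hx

/-- **`U_r` is normal in `U`** (as the subgroup `U_r ⊓ U = U_r` of `U`). [folklore] -/
instance normal_tower_subgroupOf (r : ℕ) : ((𝒰.tower r).subgroupOf 𝒰.subgroup).Normal :=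
  ⟨fun x hx u => by
    rw [Subgroup.mem_subgroupOf] at hx ⊢
    rw [Subgroup.coe_mul, Subgroup.coe_mul, Subgroup.coe_inv]
    exact 𝒰.mul_mul_inv_mem_tower u.2 hx⟩

/-! ### The spherical Hecke elements and the pair `U_r ≤ U` -/

variable {𝒰}

/-- **`u t u⁻¹ = a t a⁻¹` with `a = ι_w(u_w) ∈ U_r`** for `u ∈ U` and `t = t_{w,i}`, `w ∉ S`:
the `w`-part of `u` lies in every level, and its complement commutes with `t` (supported at `w`).
In particular `u t u⁻¹ ∈ U_r t U_r`. [folklore] -/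
theorem exists_conj_heckeElement_eq {w : HeightOneSpectrum (𝓞 K)} (hw : w ∉ 𝒰.bad) (i r : ℕ)
    (u : 𝒰.subgroup) :
    ∃ a ∈ 𝒰.tower r, ∃ b ∈ 𝒰.tower r,
      (u : FiniteAdelicGL n K) * heckeElement n K w i * (u : FiniteAdelicGL n K)⁻¹ =
        a * heckeElement n K w i * b := by
  set a := ofLocal n K w (localComponent n K w (u : FiniteAdelicGL n K)) with hadef
  have ha : a ∈ 𝒰.tower r := ofLocal_localComponent_mem_tower hw u.2 r
  have hm1 : localComponent n K w (a⁻¹ * u) = 1 := by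
    rw [map_mul, map_inv, hadef, localComponent_ofLocal, inv_mul_cancel]
  have hcomm : a⁻¹ * u * heckeElement n K w i = heckeElement n K w i * (a⁻¹ * u) := by
    rw [heckeElement_eq_ofLocal]
    exact mul_ofLocal_comm hm1 _
  refine ⟨a, ha, a⁻¹, inv_mem ha, ?_⟩
  calc (u : FiniteAdelicGL n K) * heckeElement n K w i * (u : FiniteAdelicGL n K)⁻¹
      = a * (a⁻¹ * u * heckeElement n K w i) * (u : FiniteAdelicGL n K)⁻¹ := by group
    _ = a * (heckeElement n K w i * (a⁻¹ * u)) * (u : FiniteAdelicGL n K)⁻¹ := by rw [hcomm]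
    _ = a * heckeElement n K w i * a⁻¹ := by group

/-- **The projection `G/U_r → G/U` maps `U_r t U_r / U_r` bijectively onto `U t U / U`**,
`t = t_{w,i}`, `w ∉ S` (criterion `ArithmeticQuotient.bijOn_doubleCosetQuot`: `U = U_r · (U ∩ t U t⁻¹)`
via the `w`-part of an element of `U`, and `t⁻¹ y t ∈ U ⇒ t⁻¹ y t ∈ U_r` for `y ∈ U_r` since
conjugation by `t` does not change the components above `p`). [folklore] -/
theorem bijOn_subgroup_heckeElement {w : HeightOneSpectrum (𝓞 K)} (hw : w ∉ 𝒰.bad) (i r : ℕ) :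
    Set.BijOn (Subgroup.quotientMapOfLE (𝒰.tower_le r))
      (ArithmeticQuotient.doubleCosetQuot (𝒰.tower r) (heckeElement n K w i))
      (ArithmeticQuotient.doubleCosetQuot 𝒰.subgroup (heckeElement n K w i)) := by
  have ht : ∀ w' ≠ w, localComponent n K w' (heckeElement n K w i) = 1 :=
    fun w' hw' => localComponent_heckeElement_of_ne hw' i
  refine ArithmeticQuotient.bijOn_doubleCosetQuot (𝒰.tower_le r) _ (fun l hl => ?_)
    (fun l' hl' hc => ?_)
  · -- (a) `l = a · (t m t⁻¹)` with `a = w`-part of `l`, `m = t⁻¹ (a⁻¹ l) t = a⁻¹ l`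
    set a := ofLocal n K w (localComponent n K w l) with hadef
    have hm1 : localComponent n K w (a⁻¹ * l) = 1 := by
      rw [map_mul, map_inv, hadef, localComponent_ofLocal, inv_mul_cancel]
    have hcomm : a⁻¹ * l * heckeElement n K w i = heckeElement n K w i * (a⁻¹ * l) := by
      rw [heckeElement_eq_ofLocal]
      exact mul_ofLocal_comm hm1 _
    have hconj : (heckeElement n K w i)⁻¹ * (a⁻¹ * l) * heckeElement n K w i = a⁻¹ * l := by
      rw [mul_assoc, hcomm, ← mul_assoc, inv_mul_cancel, one_mul]
    refine ⟨a, ofLocal_localComponent_mem_tower hw hl r,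
      (heckeElement n K w i)⁻¹ * (a⁻¹ * l) * heckeElement n K w i, ?_, ?_⟩
    · rw [hconj]
      exact mul_mem (inv_mem (𝒰.tower_le r (ofLocal_localComponent_mem_tower hw hl r))) hl
    · group
  · -- (b) conjugation by `t` does not change membership in `U_r`, given membership in `U`
    rw [mem_tower_iff] at hl' ⊢
    refine ⟨hc, fun w' hw' => ?_⟩
    have hw'w : w' ≠ w := fun h' => not_mem_asIdeal_of_not_mem_bad hw (h' ▸ hw')
    rw [map_mul, map_mul, map_inv, ht w' hw'w, inv_one, one_mul, mul_one]
    exact hl'.2 w' hw'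

/-- `bijOn_subgroup_heckeElement` in the form `c ↦ 1⁻¹ • translateQuot 1 _ c` used by
`TwistedQuotient.heckeFun_levelPullback` / `ArithmeticQuotient.heckeFun_comp_translateQuot`.
[folklore] -/
theorem bijOn_subgroup_heckeElement_translateQuot {w : HeightOneSpectrum (𝓞 K)} (hw : w ∉ 𝒰.bad)
    (i r : ℕ) :
    Set.BijOn (fun c => (1 : FiniteAdelicGL n K)⁻¹ •
        ArithmeticQuotient.translateQuot (1 : FiniteAdelicGL n K)
          (ArithmeticQuotient.conjInto_one_iff.2 (𝒰.tower_le r)) c)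
      (ArithmeticQuotient.doubleCosetQuot (𝒰.tower r) (heckeElement n K w i))
      (ArithmeticQuotient.doubleCosetQuot 𝒰.subgroup (heckeElement n K w i)) := by
  refine (bijOn_subgroup_heckeElement hw i r).congr fun c _ => ?_
  rw [inv_one, one_smul, ArithmeticQuotient.translateQuot_one _ (𝒰.tower_le r)]

/-- `U_r t U_r / U_r` is finite (`U_r` is compact open). [folklore] -/
theorem finite_doubleCosetQuot_tower (r : ℕ) (g : FiniteAdelicGL n K) :
    (ArithmeticQuotient.doubleCosetQuot (𝒰.tower r) g).Finite :=
  finite_orbit_quotient (𝒰.tower r) g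

variable (𝒰) in
/-- `U` is a Hecke subgroup of `GL_n(𝔸_K^∞)` (compact open). [folklore] -/
instance isHeckeTriple_subgroup :
    IsHeckeTriple (⊤ : Submonoid (FiniteAdelicGL n K)) 𝒰.subgroup 𝒰.subgroup :=
  isHeckeTriple_top_of_isCompact_isOpen _ 𝒰.isCompact 𝒰.isOpen

/-- `U t U / U` is finite (`U` is compact open). [folklore] -/
theorem finite_doubleCosetQuot_subgroup (g : FiniteAdelicGL n K) :
    (ArithmeticQuotient.doubleCosetQuot 𝒰.subgroup g).Finite :=
  finite_orbit_quotient 𝒰.subgroup g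

end TameLevel

end BigHeckeGLn

end Literature.NumberTheory.Automorphic
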